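import Mathlib.Analysis.MeanInequalities
import Mathlib.Analysis.MeanInequalitiesPow

/-!
# Klainerman–Szeftel §9.4.7 / Giorgi–Klainerman–Szeftel Remark 13.6.4: the iteration absorption, as real arithmetic

CITATION HEADER (lean-in-tree rule 2026-08-18).  This module is a kernel-checked transcription of ONE PIECE OF
BOOKKEEPING of the published papers

* S. Klainerman, J. Szeftel, *Kerr stability for small angular momentum*, arXiv:2104.11857 (v1, 2021; TeX source
  `Main-Kerr-arxiv.tex`, whose line numbers `KS l.N` are quoted) = bib key `KlainermanSzeftel2021`; journal record
  Pure Appl. Math. Q. **19** (2023) no. 3, 791–1678 = bib key `KlainermanSzeftel2023` (refereed; NOT separately read —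
  its §9.4.7 is a known point of drift, the published text is acquisition request acq-07671/07685 of the audit cell);
* E. Giorgi, S. Klainerman, J. Szeftel, *Wave equations estimates and the nonlinear stability of slowly rotating Kerr
  black holes*, arXiv:2205.14808 (v1 = the only arXiv version, 2022; TeX source `FinalKerrarxivversion.tex`, lines
  `GKS l.N`) = bib key `GiorgiKlainermanSzeftel2022`; journal record Pure Appl. Math. Q. **20** (2024) no. 7,
  2865–3849 = bib key `GiorgiKlainermanSzeftel2024` (refereed), read in the authors' version HAL hal-05348127v1
  (10 Sep 2024), pages quoted as `HAL p.N`.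

WHAT IS REPRODUCED, and in what sense.  KS Corollary 9.4.21 (`Corr:improvementoftheiterationassupmtionThM8-Mtop`,
KS l.24549–24600) — the only statement the end of the proof of the Main PT-Theorem 9.4.10 (KS §9.4.8, l.24606 ff.)
consumes — is derived in KS from Theorem 9.4.15 (here "FORM A": linear, `a`-free, KS l.24481–24490, "proved in
[GKS]") and Propositions 9.4.17–9.4.20 (KS l.24496–24545).  What GKS proves is Theorem 13.6.3 / Remark 13.6.4
("FORM B", GKS l.25953–25983 = journal Thm 13.6.3 / Remark 13.6.4, HAL p.626–627), whose consequence (v1 (13.6.8),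
journal (13.6.9)) reads
  `ℜ_{J+1} ≲ r₀^{21+δ_B} ε_J + r₀^{21/2+δ_B/2}(√𝔖_{J+1} √ε_J + ε₀) + √|a| r₀^{3+δ_B/2} 𝔖_{J+1} + r₀^{-δ_B/2} 𝔖ext_{J+1}`
  `          + r₀^{39/8+δ_B/2} 𝔖_{J+1}^{3/4} (ε₀ + √ε_J √𝔖_{J+1})^{1/4} + r₀^{39/7+4δ_B/7} 𝔖_{J+1}^{6/7} ε_J^{1/7}`
"where the constant in ≲ is independent of r₀".  Every displayed quantity is a nonnegative REAL here; the module proves,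
with every smallness condition an explicit hypothesis and nothing geometric asserted:
  §1  the Young / weighted AM–GM absorptions that linearise the sublinear terms (folklore);
  §2  `cor9421_of_formA` : KS Cor 9.4.21(1) from FORM A + Props 9.4.17, 9.4.18, 9.4.20, needing `K₁ β K₂ (K₂+2) ≤ 1/2`
      (`β = r₀^{-δ_B}`; "r₀ large enough", KS l.24585);
  §3  `cor9421_of_formB` : the same conclusion-type from the LINEARISED FORM B, needing TWO more conditions:
      `(α + θ)·K₃ ≤ 1/4` where `α = C √|a| r₀^{3+δ_B/2}` and `K₃ = K₃(r₀)` is the (r₀-DEPENDENT) constant of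
      `𝔖_{J+1} ≲ ℜ_{J+1} + ε₀ + L` from Props 9.4.17–9.4.20, and `β·K₂ ≤ 1/4` — i.e. `|a|` must be small AFTER `r₀` is
      chosen (GKS prints this order at GKS l.26758, l.26916; KS v1 (3.4.1)–(3.4.4), l.6075–6094, does not);
  §4  `formB_linearised` : FORM B ⟹ the linear shape used in §3, for every `η ∈ (0,1]`, with explicit `θ(η)`, `A(η)`;
  §5–§6 the assembled implication and the passage from the four regional Ricci estimates to the two hypotheses of §3.
Each KS- or GKS-shaped theorem carries a `[cite: …]` tag recording WHICH DISPLAY its hypotheses transcribe; the theorem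
itself is elementary real arithmetic proved here (0 sorry, axioms ⊆ {propext, Classical.choice, Quot.sound}), not a claim
about the papers' analysis.

STATUS OF THE SOURCE.  KS and GKS are refereed publications; this module neither re-proves nor disputes any analytic
estimate.  It was written by the audit cell `pub-kerr` (typed skeleton + `|a| ≪ M` census of the Klainerman–Szeftel /
Giorgi–Klainerman–Szeftel proof; manuscripts under audit enter only as explicit hypotheses).  Journal-vs-arXiv drift
relevant here (cell file CONCORDANCE.md §3): the journal Theorem 13.6.3 adds a term `(ℜ_{J+1}+𝔖_{J+1})²` to both of its
estimates and a Remark 13.6.6 declaring that such nonlinear error terms are "ignore[d] … in all subsequent estimates"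
(HAL p.627); the journal (13.6.9) accordingly carries one more final term whose coefficient is not legible in the held
text layer.  The hypothesis `h1368` below is the arXiv-v1 display (13.6.8) verbatim; the journal delta is NOT typed here.
NOT addressed here either (cell GAPS.md G-1 / E3): the NORM-SCOPE mismatch (KS `ℜ_k = ℜ* + ℜext + ℜint + ℜtop`,
KS l.24007–24010, vs GKS `ℜ_k = ℜext + ℜint`, GKS l.25772–25776) and the J-range mismatch between KS §9.4.7 and GKS §13.6.

RELATION TO EXISTING TREE MATERIAL.  `Literature.Geometry.Lorentzian.KlainermanSzeftel2021.Bootstrap` types the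
ARCHITECTURE of KS ch. 3 / §9.4 (nodes `IterStep`, `iter_to_top`, …) over an abstract carrier; this module is the real
arithmetic INSIDE one iteration step and imports nothing from it (the cell's staged `Nodes/EM8Dag.lean`, which plugs
§5 into the carver's `Dag.lean`, is proposed after `Dag.lean` lands).  `StabilityCauchy.lean` / `Stability.lean` (the
end-statement as a named fact / the summit-side conjecture) are unrelated to this bookkeeping.  Nothing here is
Final-State-Conjecture progress.

STAGING.  = the cell's staged module `KerrSkeleton/Nodes/EM8.lean` (namespace `KerrSkeleton.Nodes.EM8`, md5 43f492c1…,
clean-built in the staging package 2026-08-18), code unchanged except: namespace moved under the path, docstrings and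
provenance tags added.  Mathlib only.

## Contents
* §1 `young_sqrt`, `young_sqrt_coeff`, `young_geom`, `sqrt_mul_sqrt_rpow_quarter`, `split_three_quarter` (folklore);
* §2 `cor9421_of_formA`, `cor9421_of_formA_star`; §3 `cor9421_of_formB`, `iterate_of_formB`; §4 `formB_linearised`;
* §5 `iterate_of_remark1364`, `thetaOf`, `dataOf`, `iterate_of_remark1364_named`; §6 `S_le_of_props`.
-/

noncomputable section

namespace Literature.Geometry.Lorentzian.KlainermanSzeftel2021.IterationAbsorption

/-! ## §1 Absorption inequalities (Young / weighted AM–GM) -/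

/-- `2 η √S √e ≤ η² S + e` (from `(η√S - √e)² ≥ 0`). [folklore] -/
theorem young_sqrt {S e η : ℝ} (hS : 0 ≤ S) (he : 0 ≤ e) :
    2 * η * (Real.sqrt S * Real.sqrt e) ≤ η ^ 2 * S + e := by
  have hx : Real.sqrt S ^ 2 = S := Real.sq_sqrt hS
  have hy : Real.sqrt e ^ 2 = e := Real.sq_sqrt he
  nlinarith [sq_nonneg (η * Real.sqrt S - Real.sqrt e)]

/-- The same in the form used below: for `0 < η`, `c √S √e ≤ (c η / 2) S + (c / (2η)) e` (`c ≥ 0`). [folklore] -/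
theorem young_sqrt_coeff {S e η c : ℝ} (hS : 0 ≤ S) (he : 0 ≤ e) (hη : 0 < η) (hc : 0 ≤ c) :
    c * (Real.sqrt S * Real.sqrt e) ≤ (c * η / 2) * S + (c / (2 * η)) * e := by
  have h := young_sqrt (η := η) hS he
  have hη' : η ≠ 0 := hη.ne'
  have hre : (η / 2) * S + (1 / (2 * η)) * e = (η ^ 2 * S + e) / (2 * η) := by
    field_simp
  have h2 : Real.sqrt S * Real.sqrt e ≤ (η / 2) * S + (1 / (2 * η)) * e := by
    rw [hre, le_div_iff₀ (by positivity : (0:ℝ) < 2 * η)]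
    nlinarith [h]
  calc c * (Real.sqrt S * Real.sqrt e) ≤ c * ((η / 2) * S + (1 / (2 * η)) * e) :=
        mul_le_mul_of_nonneg_left h2 hc
    _ = (c * η / 2) * S + (c / (2 * η)) * e := by
        field_simp

/-- Weighted AM–GM with a free parameter: for `0 < θ < 1`, `0 < η`, `S, Y ≥ 0`,
`S^θ · Y^{1-θ} ≤ θ η S + (1-θ) η^{-θ/(1-θ)} Y`. [folklore] -/
theorem young_geom {S Y θ η : ℝ} (hS : 0 ≤ S) (hY : 0 ≤ Y) (hθ : 0 < θ) (hθ1 : θ < 1) (hη : 0 < η) :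
    S ^ θ * Y ^ (1 - θ) ≤ θ * (η * S) + (1 - θ) * (η ^ (-(θ / (1 - θ))) * Y) := by
  have h1θ : 0 < 1 - θ := by linarith
  have hηp : 0 ≤ η ^ (-(θ / (1 - θ))) := by positivity
  have h := Real.geom_mean_le_arith_mean2_weighted (w₁ := θ) (w₂ := 1 - θ) (p₁ := η * S)
    (p₂ := η ^ (-(θ / (1 - θ))) * Y) hθ.le h1θ.le (by positivity) (by positivity) (by ring)
  have e1 : (η * S) ^ θ = η ^ θ * S ^ θ := Real.mul_rpow hη.le hS
  have e2 : (η ^ (-(θ / (1 - θ))) * Y) ^ (1 - θ) = (η ^ (-(θ / (1 - θ)))) ^ (1 - θ) * Y ^ (1 - θ) :=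
    Real.mul_rpow hηp hY
  have e3 : (η ^ (-(θ / (1 - θ)))) ^ (1 - θ) = η ^ (-θ) := by
    rw [← Real.rpow_mul hη.le]
    congr 1
    field_simp
  have e4 : η ^ θ * η ^ (-θ) = 1 := by
    rw [← Real.rpow_add hη]; simp
  calc S ^ θ * Y ^ (1 - θ) = (η ^ θ * η ^ (-θ)) * (S ^ θ * Y ^ (1 - θ)) := by rw [e4, one_mul]
    _ = (η * S) ^ θ * (η ^ (-(θ / (1 - θ))) * Y) ^ (1 - θ) := by rw [e1, e2, e3]; ring
    _ ≤ θ * (η * S) + (1 - θ) * (η ^ (-(θ / (1 - θ))) * Y) := h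

/-- `√ε_J √S`, raised to the 1/4, splits: `(√e √S)^{1/4} = S^{1/8} e^{1/8}`. [folklore] -/
theorem sqrt_mul_sqrt_rpow_quarter {S e : ℝ} (hS : 0 ≤ S) (he : 0 ≤ e) :
    (Real.sqrt e * Real.sqrt S) ^ (1 / 4 : ℝ) = S ^ (1 / 8 : ℝ) * e ^ (1 / 8 : ℝ) := by
  rw [Real.sqrt_eq_rpow, Real.sqrt_eq_rpow, Real.mul_rpow (by positivity) (by positivity),
    ← Real.rpow_mul he, ← Real.rpow_mul hS]
  norm_num
  ring

/-- The `3/4`-term of GKS (13.6.8): `S^{3/4} (e₀ + √e_J √S)^{1/4} ≤ S^{3/4} e₀^{1/4} + S^{7/8} e_J^{1/8}`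
(sub-additivity of `x ↦ x^{1/4}`); each product is then absorbed by `young_geom` (θ = 3/4 resp. 7/8). [folklore] -/
theorem split_three_quarter {S e0 eJ : ℝ} (hS : 0 ≤ S) (he0 : 0 ≤ e0) (heJ : 0 ≤ eJ) :
    S ^ (3 / 4 : ℝ) * (e0 + Real.sqrt eJ * Real.sqrt S) ^ (1 / 4 : ℝ)
      ≤ S ^ (3 / 4 : ℝ) * e0 ^ (1 / 4 : ℝ) + S ^ (7 / 8 : ℝ) * eJ ^ (1 / 8 : ℝ) := by
  have hsub : (e0 + Real.sqrt eJ * Real.sqrt S) ^ (1 / 4 : ℝ)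
      ≤ e0 ^ (1 / 4 : ℝ) + (Real.sqrt eJ * Real.sqrt S) ^ (1 / 4 : ℝ) :=
    Real.rpow_add_le_add_rpow he0 (by positivity) (by norm_num) (by norm_num)
  have hS34 : 0 ≤ S ^ (3 / 4 : ℝ) := by positivity
  have e78 : S ^ (3 / 4 : ℝ) * (S ^ (1 / 8 : ℝ) * eJ ^ (1 / 8 : ℝ)) = S ^ (7 / 8 : ℝ) * eJ ^ (1 / 8 : ℝ) := by
    rw [← mul_assoc, ← Real.rpow_add' hS (by norm_num)]
    norm_num
  calc S ^ (3 / 4 : ℝ) * (e0 + Real.sqrt eJ * Real.sqrt S) ^ (1 / 4 : ℝ)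
      ≤ S ^ (3 / 4 : ℝ) * (e0 ^ (1 / 4 : ℝ) + (Real.sqrt eJ * Real.sqrt S) ^ (1 / 4 : ℝ)) :=
        mul_le_mul_of_nonneg_left hsub hS34
    _ = S ^ (3 / 4 : ℝ) * e0 ^ (1 / 4 : ℝ) + S ^ (3 / 4 : ℝ) * (S ^ (1 / 8 : ℝ) * eJ ^ (1 / 8 : ℝ)) := by
        rw [mul_add, sqrt_mul_sqrt_rpow_quarter hS heJ]
    _ = S ^ (3 / 4 : ℝ) * e0 ^ (1 / 4 : ℝ) + S ^ (7 / 8 : ℝ) * eJ ^ (1 / 8 : ℝ) := by rw [e78]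

/-! ## §2 KS Corollary 9.4.21(1) from FORM A (KS v1 Thm 9.4.15) and Props 9.4.17, 9.4.18, 9.4.20

Dictionary: `R = ℜ_{J+1}`, `Sstar = 𝔖*_{J+1}`, `Sext = 𝔖ext_{J+1}`, `StopFar = 𝔖top^{≥r₀}_{J+1}`, `RJ = ℜ_J`, `SJ = 𝔖_J`,
`e0 = ε₀`, `L = L_*(J+1)`, `β = r₀^{-δ_B}`, `r10 = r₀^{10}`; `K₁` = constant of Thm 9.4.15, `K₂` = common constant of
Props 9.4.17/9.4.18/9.4.20(far), all independent of r₀; regional curvature norms are bounded by the global one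
(`ℜ* ≤ ℜ`, `ℜext ≤ ℜ`, `ℜtop ≤ ℜ`, folded into h17/h18/h20).  KS l.24566–24590. -/

/-- KS Corollary 9.4.21(1) as real arithmetic: from FORM A (`h15` = KS v1 Theorem 9.4.15, l.24481–24490) and
Props 9.4.17, 9.4.18, 9.4.20 (far part) with a common r₀-independent constant `K₂`, under the explicit smallness
`K₁ β K₂ (K₂+2) ≤ 1/2` ("r₀ large enough", KS l.24585), `ℜ_{J+1}` is bounded by data.  Proved here; the tag records the
display transcribed. [cite: KlainermanSzeftel2021, Cor 9.4.21 and its proof, TeX l.24549–24600] -/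
theorem cor9421_of_formA
    {R Sstar Sext StopFar RJ SJ e0 L β r10 K1 K2 : ℝ}
    (hR : 0 ≤ R) (he0 : 0 ≤ e0) (hβ : 0 ≤ β) (hK1 : 0 ≤ K1) (hK2 : 0 ≤ K2)
    (h15 : R ≤ K1 * (β * (StopFar + Sext) + r10 * (RJ + SJ) + e0))      -- KS v1 Thm 9.4.15 (FORM A)
    (h17 : Sstar ≤ K2 * (R + e0))                                        -- Prop 9.4.17 (+ ℜ* ≤ ℜ)
    (h18 : Sext ≤ K2 * (Sstar + R + e0))                                 -- Prop 9.4.18 (+ ℜext ≤ ℜ)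
    (h20 : StopFar ≤ K2 * (e0 + L + R))                                  -- Prop 9.4.20, far part (+ ℜtop ≤ ℜ)
    (hsmall : K1 * β * K2 * (K2 + 2) ≤ 1 / 2) :                          -- "r₀ large enough"
    R ≤ (2 * K1 + 1) * e0 + 2 * K1 * K2 * β * L + 2 * K1 * r10 * (RJ + SJ) := by
  -- Sext ≤ K2 (K2+1)(R+e0),  StopFar + Sext ≤ K2 (K2+2) (R + e0) + K2 L
  have hSext : Sext ≤ K2 * (K2 + 1) * (R + e0) := by nlinarith
  have hsum : StopFar + Sext ≤ K2 * (K2 + 2) * (R + e0) + K2 * L := by nlinarith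
  have hβsum : β * (StopFar + Sext) ≤ β * (K2 * (K2 + 2) * (R + e0) + K2 * L) :=
    mul_le_mul_of_nonneg_left hsum hβ
  have h1 : R ≤ K1 * (β * (K2 * (K2 + 2) * (R + e0) + K2 * L) + r10 * (RJ + SJ) + e0) := by
    have := mul_le_mul_of_nonneg_left (add_le_add_right (add_le_add_right hβsum (r10 * (RJ + SJ))) e0) hK1
    linarith
  -- absorb (K1 β K2 (K2+2)) R ≤ R/2
  have h2 : K1 * β * K2 * (K2 + 2) * R ≤ (1 / 2) * R := mul_le_mul_of_nonneg_right hsmall hR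
  have h3 : K1 * β * K2 * (K2 + 2) * e0 ≤ (1 / 2) * e0 := mul_le_mul_of_nonneg_right hsmall he0
  nlinarith

/-- KS Cor 9.4.21(1) packaged with `𝔖*`: `ℜ_{J+1} + 𝔖*_{J+1} ≤ …` (explicit constants). Proved here.
[cite: KlainermanSzeftel2021, Cor 9.4.21(1), TeX l.24549–24560] -/
theorem cor9421_of_formA_star {R Sstar Sext StopFar RJ SJ e0 L β r10 K1 K2 : ℝ}
    (hR : 0 ≤ R) (he0 : 0 ≤ e0) (hβ : 0 ≤ β) (hK1 : 0 ≤ K1) (hK2 : 0 ≤ K2)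
    (h15 : R ≤ K1 * (β * (StopFar + Sext) + r10 * (RJ + SJ) + e0))
    (h17 : Sstar ≤ K2 * (R + e0)) (h18 : Sext ≤ K2 * (Sstar + R + e0))
    (h20 : StopFar ≤ K2 * (e0 + L + R)) (hsmall : K1 * β * K2 * (K2 + 2) ≤ 1 / 2) :
    R + Sstar ≤ (1 + K2) * ((2 * K1 + 1) * e0 + 2 * K1 * K2 * β * L + 2 * K1 * r10 * (RJ + SJ)) + K2 * e0 := by
  have h := cor9421_of_formA hR he0 hβ hK1 hK2 h15 h17 h18 h20 hsmall
  have hK2R : K2 * R ≤ K2 * ((2 * K1 + 1) * e0 + 2 * K1 * K2 * β * L + 2 * K1 * r10 * (RJ + SJ)) :=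
    mul_le_mul_of_nonneg_left h hK2
  nlinarith

/-! ## §3 The same conclusion-type from the LINEARISED FORM B of GKS

Dictionary: `S = 𝔖_{J+1}` (global), `Sext = 𝔖ext_{J+1}`; `hB` is GKS v1 (13.6.8) after the §1/§4 absorptions:
`R ≤ A + α S + β Sext + θ S` with `α = C √|a| r₀^{3+δ_B/2}`, `β = C r₀^{-δ_B/2}`, `θ = θ(η)` the sum of the Young
coefficients, `A = A(η, r₀)·(ε_J + ε₀)`-type data term; `hSext` = Props 9.4.17+9.4.18 (constant `K₂` independent of r₀),
`hS` = Props 9.4.17–9.4.20 summed (constant `K₃ = K₃(r₀)`, r₀-DEPENDENT because of 9.4.19 and the near part of 9.4.20).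
The two smallness hypotheses are exactly: r₀ large (h2) and THEN η, |a| small relative to K₃(r₀) (h1). -/

/-- The KS Cor 9.4.21 conclusion-type from the LINEARISED FORM B: `ℜ ≤ 2A + ε₀ + L/2` under `(α + θ)·K₃ ≤ 1/4`
(|a| and η small AFTER r₀) and `β·K₂ ≤ 1/4` (r₀ large).  Proved here; the hypothesis shapes transcribe GKS Remark
13.6.4 (v1 (13.6.8), linearised) and KS Props 9.4.17–9.4.20.
[cite: GiorgiKlainermanSzeftel2022, Remark 13.6.4 (13.6.8), TeX l.25974–25983; journal GiorgiKlainermanSzeftel2024 Remark 13.6.4 (13.6.9), HAL p.627] -/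
theorem cor9421_of_formB
    {R S Sext e0 L A α β θ K2 K3 : ℝ}
    (hR : 0 ≤ R) (he0 : 0 ≤ e0) (hL : 0 ≤ L) (hα : 0 ≤ α) (hβ : 0 ≤ β) (hθ : 0 ≤ θ)
    (hB : R ≤ A + α * S + β * Sext + θ * S)           -- (13.6.8) linearised (§4)
    (hSext : Sext ≤ K2 * (R + e0))                      -- Props 9.4.17 + 9.4.18, K₂ independent of r₀
    (hS : S ≤ K3 * (R + e0 + L))                        -- Props 9.4.17–9.4.20, K₃ = K₃(r₀)
    (h1 : (α + θ) * K3 ≤ 1 / 4)                         -- |a| and η small AFTER r₀: C√|a| r₀^{3+δ_B/2} K₃(r₀) ≤ 1/4 - θK₃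
    (h2 : β * K2 ≤ 1 / 4) :                             -- r₀ large: C r₀^{-δ_B/2} K₂ ≤ 1/4
    R ≤ 2 * A + e0 + L / 2 := by
  have hαθ : 0 ≤ α + θ := by positivity
  have e1 : (α + θ) * S ≤ (α + θ) * (K3 * (R + e0 + L)) := mul_le_mul_of_nonneg_left hS hαθ
  have e2 : β * Sext ≤ β * (K2 * (R + e0)) := mul_le_mul_of_nonneg_left hSext hβ
  have e3 : (α + θ) * K3 * (R + e0 + L) ≤ (1 / 4) * (R + e0 + L) :=
    mul_le_mul_of_nonneg_right h1 (by positivity)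
  have e4 : β * K2 * (R + e0) ≤ (1 / 4) * (R + e0) := mul_le_mul_of_nonneg_right h2 (by positivity)
  nlinarith

/-- … and then the iteration quantity `ℜ_{J+1} + 𝔖_{J+1}` is bounded by data: this is the shape of the GKS iteration
assumption (v1 (13.6.4), journal (13.6.2)) "with J replaced by J+1", with `ε_{J+1} := (1+K₃)(2A + ε₀ + L/2) + K₃(ε₀ + L)`.
Proved here. [cite: GiorgiKlainermanSzeftel2022, Remark 13.6.4 iteration sentence, TeX l.25981–25982; journal HAL p.627] -/
theorem iterate_of_formB {R S Sext e0 L A α β θ K2 K3 : ℝ}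
    (hR : 0 ≤ R) (he0 : 0 ≤ e0) (hL : 0 ≤ L) (hα : 0 ≤ α) (hβ : 0 ≤ β) (hθ : 0 ≤ θ) (hK3 : 0 ≤ K3)
    (hB : R ≤ A + α * S + β * Sext + θ * S) (hSext : Sext ≤ K2 * (R + e0)) (hS : S ≤ K3 * (R + e0 + L))
    (h1 : (α + θ) * K3 ≤ 1 / 4) (h2 : β * K2 ≤ 1 / 4) :
    R + S ≤ (1 + K3) * (2 * A + e0 + L / 2) + K3 * (e0 + L) := by
  have h := cor9421_of_formB hR he0 hL hα hβ hθ hB hSext hS h1 h2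
  have : K3 * R ≤ K3 * (2 * A + e0 + L / 2) := mul_le_mul_of_nonneg_left h hK3
  nlinarith

/-! ## §4 FORM B ⟹ the linear shape, for every η ∈ (0,1]

`c₁ … c₄ ≥ 0` are the r₀-powers of GKS v1 (13.6.8) times its hidden constant: c₁ = C r₀^{21+δ_B}, c₂ = C r₀^{21/2+δ_B/2},
c₃ = C r₀^{39/8+δ_B/2}, c₄ = C r₀^{39/7+4δ_B/7}; α = C √|a| r₀^{3+δ_B/2}, β = C r₀^{-δ_B/2}. -/

/-- GKS v1 (13.6.8) (hypothesis `h`, verbatim shape over nonnegative reals) implies, for every `η > 0`, the linear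
shape `R ≤ A(η) + α S + β Sext + θ(η) S` with explicit `A(η)`, `θ(η)`.  Proved here (Young absorptions of §1).
[cite: GiorgiKlainermanSzeftel2022, Remark 13.6.4 (13.6.8), TeX l.25974–25983; journal GiorgiKlainermanSzeftel2024 (13.6.9), HAL p.627] -/
theorem formB_linearised
    {R S Sext e0 eJ α β c1 c2 c3 c4 η : ℝ}
    (hS : 0 ≤ S) (he0 : 0 ≤ e0) (heJ : 0 ≤ eJ) (hc2 : 0 ≤ c2) (hc3 : 0 ≤ c3) (hc4 : 0 ≤ c4)
    (hη : 0 < η)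
    (h : R ≤ c1 * eJ + c2 * (Real.sqrt S * Real.sqrt eJ + e0) + α * S + β * Sext
            + c3 * (S ^ (3 / 4 : ℝ) * (e0 + Real.sqrt eJ * Real.sqrt S) ^ (1 / 4 : ℝ))
            + c4 * (S ^ (6 / 7 : ℝ) * eJ ^ (1 / 7 : ℝ))) :
    R ≤ (c1 * eJ + c2 * e0 + (c2 / (2 * η)) * eJ
            + c3 * ((1 / 4 : ℝ) * (η ^ (-((3 / 4 : ℝ) / (1 - 3 / 4))) * e0))
            + c3 * ((1 / 8 : ℝ) * (η ^ (-((7 / 8 : ℝ) / (1 - 7 / 8))) * eJ))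
            + c4 * ((1 / 7 : ℝ) * (η ^ (-((6 / 7 : ℝ) / (1 - 6 / 7))) * eJ)))
        + α * S + β * Sext
        + (c2 * η / 2 + c3 * ((3 / 4 : ℝ) * η + (7 / 8 : ℝ) * η) + c4 * ((6 / 7 : ℝ) * η)) * S := by
  -- the √ term
  have t2 : c2 * (Real.sqrt S * Real.sqrt eJ) ≤ (c2 * η / 2) * S + (c2 / (2 * η)) * eJ :=
    young_sqrt_coeff hS heJ hη hc2
  -- the 3/4 term
  have t3a := split_three_quarter hS he0 heJ
  have y34 : S ^ (3 / 4 : ℝ) * e0 ^ (1 - 3 / 4 : ℝ) ≤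
      (3 / 4 : ℝ) * (η * S) + (1 - 3 / 4 : ℝ) * (η ^ (-((3 / 4 : ℝ) / (1 - 3 / 4))) * e0) :=
    young_geom hS he0 (by norm_num) (by norm_num) hη
  have y78 : S ^ (7 / 8 : ℝ) * eJ ^ (1 - 7 / 8 : ℝ) ≤
      (7 / 8 : ℝ) * (η * S) + (1 - 7 / 8 : ℝ) * (η ^ (-((7 / 8 : ℝ) / (1 - 7 / 8))) * eJ) :=
    young_geom hS heJ (by norm_num) (by norm_num) hη
  have y67 : S ^ (6 / 7 : ℝ) * eJ ^ (1 - 6 / 7 : ℝ) ≤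
      (6 / 7 : ℝ) * (η * S) + (1 - 6 / 7 : ℝ) * (η ^ (-((6 / 7 : ℝ) / (1 - 6 / 7))) * eJ) :=
    young_geom hS heJ (by norm_num) (by norm_num) hη
  have r1 : (1 - 3 / 4 : ℝ) = 1 / 4 := by norm_num
  have r2 : (1 - 7 / 8 : ℝ) = 1 / 8 := by norm_num
  have r3 : (1 - 6 / 7 : ℝ) = 1 / 7 := by norm_num
  rw [r1] at y34; rw [r2] at y78; rw [r3] at y67
  have t3 : c3 * (S ^ (3 / 4 : ℝ) * (e0 + Real.sqrt eJ * Real.sqrt S) ^ (1 / 4 : ℝ)) ≤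
      c3 * ((3 / 4 : ℝ) * (η * S) + (1 / 4 : ℝ) * (η ^ (-((3 / 4 : ℝ) / (1 - 3 / 4))) * e0)
          + ((7 / 8 : ℝ) * (η * S) + (1 / 8 : ℝ) * (η ^ (-((7 / 8 : ℝ) / (1 - 7 / 8))) * eJ))) := by
    have := mul_le_mul_of_nonneg_left (le_trans t3a (add_le_add y34 y78)) hc3
    simpa [r1, r2] using this
  have t4 : c4 * (S ^ (6 / 7 : ℝ) * eJ ^ (1 / 7 : ℝ)) ≤
      c4 * ((6 / 7 : ℝ) * (η * S) + (1 / 7 : ℝ) * (η ^ (-((6 / 7 : ℝ) / (1 - 6 / 7))) * eJ)) := by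
    have := mul_le_mul_of_nonneg_left y67 hc4
    simpa [r3] using this
  have hc2' : c2 * (Real.sqrt S * Real.sqrt eJ + e0) = c2 * (Real.sqrt S * Real.sqrt eJ) + c2 * e0 := by ring
  rw [hc2'] at h
  nlinarith [t2, t3, t4]

/-! ## §5 Assembly: (13.6.8) + KS Props 9.4.17–9.4.20 + the three smallness conditions ⟹ the next iteration bound

This is the audit cell's edge E-M8 as ONE kernel-checked implication over reals.  Reading of the hypotheses: `h1368` = GKS v1
(13.6.8) verbatim shape; `hSext`, `hS` = KS Props 9.4.17–9.4.20 (with ℜ-regional ≤ ℜ-global folded in); `hr0` = "r₀ large"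
(β K₂ ≤ 1/4, K₂ independent of r₀ — KS l.24500, l.24511); `ha` = "η and |a| small AFTER r₀": (α + θ(η)) K₃(r₀) ≤ 1/4 with
θ(η) = c₂η/2 + c₃(3/4 + 7/8)η + c₄(6/7)η.  Since c₂, c₃, c₄ grow like r₀^{21/2+…}, r₀^{39/8+…}, r₀^{39/7+…} and K₃ = K₃(r₀),
`ha` forces η ≲ r₀^{-(21/2+δ_B/2)} K₃(r₀)⁻¹ and √|a| ≲ r₀^{-(3+δ_B/2)} K₃(r₀)⁻¹: the quantifier order r₀ → (η, a) → ε₀ of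
GKS l.26758/26916, absent from KS v1 (3.4.1)–(3.4.4).  Conclusion = "iteration assumption at J+1" with
ε_{J+1} := (1+K₃)(2A(η) + ε₀ + L/2) + K₃(ε₀ + L), A(η) polynomial in η⁻¹ (degree 7) times (ε_J, ε₀). -/

/-- E-M8 assembled: GKS v1 (13.6.8) + KS Props 9.4.17–9.4.20 (as `hSext`, `hS`) + `ha` (η, |a| small after r₀) + `hr0`
(r₀ large) ⟹ `ℜ_{J+1} + 𝔖_{J+1} ≤ ε_{J+1}` with the explicit `ε_{J+1}` displayed.  Proved here.
[cite: GiorgiKlainermanSzeftel2022, Remark 13.6.4, TeX l.25974–25983; journal GiorgiKlainermanSzeftel2024 Remark 13.6.4, HAL p.627] -/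
theorem iterate_of_remark1364
    {R S Sext e0 eJ L α β c1 c2 c3 c4 η K2 K3 : ℝ}
    (hR : 0 ≤ R) (hS0 : 0 ≤ S) (he0 : 0 ≤ e0) (heJ : 0 ≤ eJ) (hL : 0 ≤ L)
    (hα : 0 ≤ α) (hβ : 0 ≤ β) (hc2 : 0 ≤ c2) (hc3 : 0 ≤ c3) (hc4 : 0 ≤ c4) (hη : 0 < η) (hK3 : 0 ≤ K3)
    (h1368 : R ≤ c1 * eJ + c2 * (Real.sqrt S * Real.sqrt eJ + e0) + α * S + β * Sext
            + c3 * (S ^ (3 / 4 : ℝ) * (e0 + Real.sqrt eJ * Real.sqrt S) ^ (1 / 4 : ℝ))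
            + c4 * (S ^ (6 / 7 : ℝ) * eJ ^ (1 / 7 : ℝ)))
    (hSext : Sext ≤ K2 * (R + e0))
    (hS : S ≤ K3 * (R + e0 + L))
    (ha : (α + (c2 * η / 2 + c3 * ((3 / 4 : ℝ) * η + (7 / 8 : ℝ) * η) + c4 * ((6 / 7 : ℝ) * η))) * K3 ≤ 1 / 4)
    (hr0 : β * K2 ≤ 1 / 4) :
    R + S ≤ (1 + K3) * (2 * (c1 * eJ + c2 * e0 + (c2 / (2 * η)) * eJ
            + c3 * ((1 / 4 : ℝ) * (η ^ (-((3 / 4 : ℝ) / (1 - 3 / 4))) * e0))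
            + c3 * ((1 / 8 : ℝ) * (η ^ (-((7 / 8 : ℝ) / (1 - 7 / 8))) * eJ))
            + c4 * ((1 / 7 : ℝ) * (η ^ (-((6 / 7 : ℝ) / (1 - 6 / 7))) * eJ))) + e0 + L / 2)
          + K3 * (e0 + L) := by
  have hlin := formB_linearised (R := R) (Sext := Sext) (α := α) (β := β) (c1 := c1)
    hS0 he0 heJ hc2 hc3 hc4 hη h1368
  have hθ : 0 ≤ c2 * η / 2 + c3 * ((3 / 4 : ℝ) * η + (7 / 8 : ℝ) * η) + c4 * ((6 / 7 : ℝ) * η) := by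
    positivity
  exact iterate_of_formB hR he0 hL hα hβ hθ hK3 hlin hSext hS ha hr0

/-! ## §6 From the four regional Ricci estimates to the two hypotheses `hSext`, `hS` of §3–§5

KS Props 9.4.17–9.4.20 with ONE constant `C`, the regional curvature norms bounded by the global one, and
`𝔖 ≤ 𝔖* + 𝔖ext + 𝔖int + 𝔖top` (KS (9.4.7)–(9.4.9), l.24004–24010) give `𝔖ext ≤ C(C+1)(ℜ + ε₀)` and
`𝔖 ≤ 4(C+1)³(ℜ + ε₀ + L)`.  CAVEAT: with a single `C` the r₀-independence of the 9.4.17/9.4.18 constants — which is what makes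
`β·K₂ ≤ 1/4` meetable by taking r₀ large — is no longer visible in the type. -/

/-- KS Props 9.4.17–9.4.20 (one constant `C`, regional `ℜ`'s ≤ global `ℜ`, `𝔖 ≤ Σ parts`) ⟹ `𝔖ext ≤ C(C+1)(ℜ+ε₀)` and
`𝔖 ≤ 4(C+1)³(ℜ+ε₀+L)`.  Proved here; the hypothesis shapes transcribe the four displayed propositions.
[cite: KlainermanSzeftel2021, Props 9.4.17–9.4.20, TeX l.24496–24545] -/
theorem S_le_of_props {Sstar Sext Sint Stop S R Rstar Rext Rint Rtop e0 L C : ℝ}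
    (hC : 0 ≤ C) (hR : 0 ≤ R) (he0 : 0 ≤ e0) (hL : 0 ≤ L)
    (h17 : Sstar ≤ C * (Rstar + e0)) (h18 : Sext ≤ C * (Sstar + Rext + e0))
    (h19 : Sint ≤ C * (Sext + Rint + e0)) (h20 : Stop ≤ C * (e0 + L + Rtop))
    (hRs : Rstar ≤ R) (hRe : Rext ≤ R) (hRi : Rint ≤ R) (hRt : Rtop ≤ R)
    (hsum : S ≤ Sstar + Sext + Sint + Stop) :
    Sext ≤ C * (C + 1) * (R + e0) ∧ S ≤ 4 * (C + 1) ^ 3 * (R + e0 + L) := by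
  have hX : 0 ≤ R + e0 := by positivity
  have s17 : Sstar ≤ C * (R + e0) := by nlinarith
  have s18 : Sext ≤ C * (C + 1) * (R + e0) := by nlinarith
  have s19 : Sint ≤ C * (C * (C + 1) + 1) * (R + e0) := by nlinarith
  have s20 : Stop ≤ C * (R + e0 + L) := by nlinarith
  refine ⟨s18, ?_⟩
  have e3 : (C + 1) ^ 3 = C ^ 3 + 3 * C ^ 2 + 3 * C + 1 := by ring
  have hp3 : 0 ≤ C ^ 3 := pow_nonneg hC 3
  have hp2 : 0 ≤ C ^ 2 := sq_nonneg C
  have hC1 : C ≤ (C + 1) ^ 3 := by rw [e3]; nlinarith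
  have hC2 : C * (C + 1) ≤ (C + 1) ^ 3 := by rw [e3]; nlinarith
  have hC3 : C * (C * (C + 1) + 1) ≤ (C + 1) ^ 3 := by rw [e3]; nlinarith
  have hD3 : 0 ≤ (C + 1) ^ 3 := by positivity
  have hXL : 0 ≤ R + e0 + L := by positivity
  have hXle : R + e0 ≤ R + e0 + L := by linarith
  have t1 : C * (R + e0) ≤ (C + 1) ^ 3 * (R + e0 + L) :=
    (mul_le_mul_of_nonneg_left hXle hC).trans (mul_le_mul_of_nonneg_right hC1 hXL)
  have t2 : C * (C + 1) * (R + e0) ≤ (C + 1) ^ 3 * (R + e0 + L) :=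
    (mul_le_mul_of_nonneg_left hXle (by positivity)).trans (mul_le_mul_of_nonneg_right hC2 hXL)
  have t3 : C * (C * (C + 1) + 1) * (R + e0) ≤ (C + 1) ^ 3 * (R + e0 + L) :=
    (mul_le_mul_of_nonneg_left hXle (by positivity)).trans (mul_le_mul_of_nonneg_right hC3 hXL)
  have t4 : C * (R + e0 + L) ≤ (C + 1) ^ 3 * (R + e0 + L) := mul_le_mul_of_nonneg_right hC1 hXL
  linarith

/-- The Young-coefficient sum `θ(η) = c₂η/2 + c₃(3/4 + 7/8)η + c₄(6/7)η` of §4–§5, named (bookkeeping introduced by this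
transcription; no counterpart display in the papers). [folklore] -/
def thetaOf (c2 c3 c4 η : ℝ) : ℝ :=
  c2 * η / 2 + c3 * ((3 / 4 : ℝ) * η + (7 / 8 : ℝ) * η) + c4 * ((6 / 7 : ℝ) * η)

/-- The data term `A(η) = c₁ε_J + c₂ε₀ + (c₂/2η)ε_J + (c₃/4)η^{-3}ε₀ + (c₃/8)η^{-7}ε_J + (c₄/7)η^{-6}ε_J` of §4–§5 (exponents
kept in the un-normalised form `-(θ/(1-θ))` produced by `young_geom`; bookkeeping of this transcription). [folklore] -/
def dataOf (c1 c2 c3 c4 η e0 eJ : ℝ) : ℝ :=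
  c1 * eJ + c2 * e0 + (c2 / (2 * η)) * eJ
    + c3 * ((1 / 4 : ℝ) * (η ^ (-((3 / 4 : ℝ) / (1 - 3 / 4))) * e0))
    + c3 * ((1 / 8 : ℝ) * (η ^ (-((7 / 8 : ℝ) / (1 - 7 / 8))) * eJ))
    + c4 * ((1 / 7 : ℝ) * (η ^ (-((6 / 7 : ℝ) / (1 - 6 / 7))) * eJ))

/-- §5 restated with the named `thetaOf` / `dataOf`.  Proved here.
[cite: GiorgiKlainermanSzeftel2022, Remark 13.6.4, TeX l.25974–25983; journal GiorgiKlainermanSzeftel2024 Remark 13.6.4, HAL p.627] -/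
theorem iterate_of_remark1364_named {R S Sext e0 eJ L α β c1 c2 c3 c4 η K2 K3 : ℝ}
    (hR : 0 ≤ R) (hS0 : 0 ≤ S) (he0 : 0 ≤ e0) (heJ : 0 ≤ eJ) (hL : 0 ≤ L)
    (hα : 0 ≤ α) (hβ : 0 ≤ β) (hc2 : 0 ≤ c2) (hc3 : 0 ≤ c3) (hc4 : 0 ≤ c4) (hη : 0 < η) (hK3 : 0 ≤ K3)
    (h1368 : R ≤ c1 * eJ + c2 * (Real.sqrt S * Real.sqrt eJ + e0) + α * S + β * Sext
            + c3 * (S ^ (3 / 4 : ℝ) * (e0 + Real.sqrt eJ * Real.sqrt S) ^ (1 / 4 : ℝ))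
            + c4 * (S ^ (6 / 7 : ℝ) * eJ ^ (1 / 7 : ℝ)))
    (hSext : Sext ≤ K2 * (R + e0)) (hS : S ≤ K3 * (R + e0 + L))
    (ha : (α + thetaOf c2 c3 c4 η) * K3 ≤ 1 / 4) (hr0 : β * K2 ≤ 1 / 4) :
    R + S ≤ (1 + K3) * (2 * dataOf c1 c2 c3 c4 η e0 eJ + e0 + L / 2) + K3 * (e0 + L) := by
  unfold thetaOf at ha
  unfold dataOf
  exact iterate_of_remark1364 hR hS0 he0 heJ hL hα hβ hc2 hc3 hc4 hη hK3 h1368 hSext hS ha hr0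

end Literature.Geometry.Lorentzian.KlainermanSzeftel2021.IterationAbsorption

end
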